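import Summits.Ventures.DiscreteObjects.Hadamard.CyclicCorePAF
import Literature.Combinatorics.Designs.LegendrePairs.Mod3Obstruction333

/-!
# Small tools on periodic autocorrelations: `PAF ≡ n (mod 4)`, reversal symmetry, reflected sequences (kernel, general)

Framing: lottery ticket; floor = certified bounds/negative ranges.

Cell pub-namedobj (venture DiscreteObjects), target (H), hadamard gen 19.  Elementary facts about `±1` sequences on `ZMod n` used by
`Order333Dihedral668`: (1) **`paf_mod_four`**: `PAF_c(s) ≡ n (mod 4)` for a `±1` sequence (the number of indices with
`c_i c_{i+s} = −1` is even, because `∏_i c_i c_{i+s} = (∏ c)² = 1`); hence (`legendrePair333_paf_ne`) the two sequences of a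
Legendre pair of length `333` cannot have equal autocorrelations (`2·PAF = −2` would give `PAF = −1 ≢ 333 (mod 4)`);
(2) **`PAF_neg`**, **`paf_eq_of_reflect`**: `PAF_c(−s) = PAF_c(s)`, and a sequence reflected from another (`b (C − t) = η a t`,
`η = ±1`) has the same autocorrelations; (3) **`eta_eq_one_of_reflect`**, **`symmetric_translate_of_reflect`** (length `333`): a
self-reflection `a (C − t) = η a t` of a `±1` sequence has `η = 1` (look at the fixed point `t₀ = 167·C`, `2·167 ≡ 1`) and then the
translate `i ↦ a (i + t₀)` is symmetric.  Ours; no `sorry`, no definitions.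
-/

namespace Summit.Ventures.DiscreteObjects.Hadamard

open Finset BigOperators

open Literature.Combinatorics.Designs.LegendrePairs (PAF IsPM LegendrePair)

section general
variable {n : ℕ} [NeZero n]

/-- **`PAF ≡ n (mod 4)`** for a `±1` sequence. -/
theorem paf_mod_four (c : ZMod n → ℤ) (hc : IsPM c) (s : ZMod n) : ∃ k : ℤ, PAF c s = n - 4 * k := by
  set N := (univ.filter fun i : ZMod n => c i * c (i + s) = -1).card with hN
  have hterm : ∀ i : ZMod n, c i * c (i + s) = if c i * c (i + s) = -1 then -1 else 1 := by
    intro i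
    split_ifs with h
    · exact h
    · rcases hc i with h1 | h1 <;> rcases hc (i + s) with h2 | h2 <;> simp_all
  -- PAF = n - 2N
  have hsum : PAF c s = n - 2 * N := by
    unfold PAF
    rw [Finset.sum_congr rfl fun i _ => hterm i, Finset.sum_ite, Finset.sum_const, Finset.sum_const, smul_neg,
      nsmul_eq_mul, nsmul_eq_mul, mul_one, ← hN]
    have hsplit := Finset.card_filter_add_card_filter_not (s := (univ : Finset (ZMod n))) (fun i => c i * c (i + s) = -1)
    rw [Finset.card_univ, ZMod.card, ← hN] at hsplit
    have h2 : ((univ.filter fun i : ZMod n => ¬ c i * c (i + s) = -1).card : ℤ) = n - N := by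
      have : (N : ℤ) + (univ.filter fun i : ZMod n => ¬ c i * c (i + s) = -1).card = n := by exact_mod_cast hsplit
      linarith
    rw [h2]; ring
  -- the product is 1, so N is even
  have hprod : ∏ i : ZMod n, (c i * c (i + s)) = 1 := by
    rw [Finset.prod_mul_distrib, Fintype.prod_equiv (Equiv.addRight s) (fun i => c (i + s)) c (fun i => rfl), ← sq]
    rcases prod_pm univ c (fun i _ => hc i) with h | h <;> rw [h] <;> norm_num
  have hprod' : ∏ i : ZMod n, (c i * c (i + s)) = (-1) ^ N := by
    rw [Finset.prod_congr rfl fun i _ => hterm i, Finset.prod_ite, Finset.prod_const, Finset.prod_const, one_pow,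
      mul_one, ← hN]
  rw [hprod'] at hprod
  have hev : Even N := (neg_one_pow_eq_one_iff_even (by norm_num)).mp hprod
  obtain ⟨k, hk⟩ := hev
  exact ⟨k, by rw [hsum, hk]; push_cast; ring⟩

/-- `PAF_c(−s) = PAF_c(s)` -/
theorem PAF_neg (c : ZMod n → ℤ) (s : ZMod n) : PAF c (-s) = PAF c s := by
  unfold PAF
  rw [← Equiv.sum_comp (Equiv.addRight s) (fun i => c i * c (i + -s))]
  refine Finset.sum_congr rfl fun i _ => ?_
  simp only [Equiv.coe_addRight]
  rw [show i + s + -s = i by ring, mul_comm]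

/-- a reflected copy has the same autocorrelations: `b (C − t) = η a t` (`η = ±1`) ⇒ `PAF_b = PAF_a` -/
theorem paf_eq_of_reflect (a b : ZMod n → ℤ) {η : ℤ} (hη : η = 1 ∨ η = -1) (C : ZMod n)
    (h : ∀ t, b (C - t) = η * a t) (s : ZMod n) : PAF b s = PAF a s := by
  have hη2 : η * η = 1 := pm_mul_self hη
  rw [← PAF_neg a s]
  unfold PAF
  rw [← Equiv.sum_comp (Equiv.subLeft C) (fun i => b i * b (i + s))]
  refine Finset.sum_congr rfl fun u _ => ?_
  simp only [Equiv.subLeft_apply]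
  rw [h u, show C - u + s = C - (u + -s) by ring, h (u + -s)]
  calc η * a u * (η * a (u + -s)) = (η * η) * (a u * a (u + -s)) := by ring
    _ = a u * a (u + -s) := by rw [hη2, one_mul]

end general

/-! ### length 333: reflections have `η = +1` and give symmetric translates; Legendre pairs have unequal PAFs -/

/-- `2 · 167 = 1` in `ZMod 333` -/
lemma two_mul_167_zmod333 : (2 : ZMod 333) * 167 = 1 := by decide

/-- a self-reflection of a `±1` sequence of length `333` has sign `+1` -/
theorem eta_eq_one_of_reflect (a : ZMod 333 → ℤ) (ha : IsPM a) {η : ℤ} (hη : η = 1 ∨ η = -1) (C : ZMod 333)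
    (h : ∀ t, a (C - t) = η * a t) : η = 1 := by
  rcases hη with hη | hη
  · exact hη
  · exfalso
    have hfix : C - 167 * C = 167 * C := by
      have := two_mul_167_zmod333
      linear_combination (-C) * this
    have h0 := h (167 * C)
    rw [hfix, hη] at h0
    rcases ha (167 * C) with h1 | h1 <;> rw [h1] at h0 <;> norm_num at h0

/-- … and then the translate by `t₀ = 167·C` is symmetric -/
theorem symmetric_translate_of_reflect (a : ZMod 333 → ℤ) (C : ZMod 333) (h : ∀ t, a (C - t) = a t) :
    ∀ i, Literature.Combinatorics.Designs.LegendrePairs.translate a (167 * C) (-i) = Literature.Combinatorics.Designs.LegendrePairs.translate a (167 * C) i := by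
  intro i
  unfold Literature.Combinatorics.Designs.LegendrePairs.translate
  have : -i + 167 * C = C - (i + 167 * C) := by
    have := two_mul_167_zmod333
    linear_combination C * this
  rw [this, h]

/-- **the two sequences of a Legendre pair of length 333 have different autocorrelations somewhere** — in fact everywhere off
`0`: `PAF_a(s) = PAF_b(s)` with `PAF_a + PAF_b = −2` gives `PAF_a(s) = −1 ≢ 333 (mod 4)`. -/
theorem legendrePair333_paf_ne (a b : ZMod 333 → ℤ) (hL : LegendrePair a b) {s : ZMod 333} (hs : s ≠ 0)
    (heq : PAF b s = PAF a s) : False := by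
  obtain ⟨ha, -, hpaf⟩ := hL
  have h2 := hpaf s hs
  rw [heq] at h2
  obtain ⟨k, hk⟩ := paf_mod_four a ha s
  push_cast at hk
  omega

end Summit.Ventures.DiscreteObjects.Hadamard
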